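import Mathlib
import Summits.ResolutionOfSingularities.ResolutionOfSingularities.Theorems.WildQuotientsWildQuotientResolutionSqZeroNormalForm
import Summits.ResolutionOfSingularities.ResolutionOfSingularities.Theorems.WildQuotientsWildQuotientResolutionLinearSmallBlocksFinal
import Summits.ResolutionOfSingularities.ResolutionOfSingularities.Theorems.WildQuotientsWildQuotientResolutionFixedPointsConj

/-!
# Rung SQZ: every LINEAR `σ` on `k[x₁,…,xₙ]` with `(σ − 1)² = 0` — in particular every linear
# involution in characteristic `2` — has a resolvable quotient `𝔸ⁿ/σ`

(crux stmt-ResolutionOfSingularities-15640 `WildQuotients.WildQuotientResolution`, line `Sketch`,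
sector `|G| = p`; rung SQZ of `L/w45c/W45cPlanSignaturesV4.lean` §A, candidates SQZ-2, SQZ-3, SQZ-4
VERBATIM; [OURS · L1 W4.5c] — NOT a statement of any manuscript.)

* `exists_algEquiv_apply_X_eq` — linear changes of coordinates: every basis `b` of the degree-one
  part `V₁ = span (X i)` of `k[x₁,…,xₙ]` is `(φ (X i))ᵢ` for a `k`-algebra automorphism `φ`
  (`φ = aeval b`; its inverse is `aeval` of the coordinates of the `X i` in `b`, the second
  one-sided inverse identity coming from `mul_eq_one_comm` on the finite-dimensional `V₁`).
* `exists_conj_linearSmallBlocks_of_sq_zero` — **SQZ-2**: a LINEAR `σ` (`σ (X i) ∈ V₁`) with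
  `(σ − 1)² = 0` on the coordinates is conjugate in `Aut_k k[x]` to a linear-small-blocks datum
  (`σ xᵢ = xᵢ + x_{f i}` on `D`, identity off `D`, `f(D) ∩ D = ∅`), by the square-zero normal form
  `LinearSqZero.exists_basis_of_sq_zero_index` applied to `N = σ − 1` on `V₁`.
* `linearSqZero_hasResolution` — **SQZ-3**: hence `Spec k[x]^⟨σ⟩` has a resolution of
  singularities in every characteristic `p` and every `n` (rung LSB
  `LinearSmallBlocks.hasResolution`, p471938, for the conjugate, transported back along
  `TameTransfer.hasResolution_fixedPoints_zpowers_conj`, p471072).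
* `linearInvolution_hasResolution_charTwo` — **SQZ-4**: EVERY linear involution `σ` of `𝔸ⁿ_k`,
  `char k = 2`, has a resolvable quotient `𝔸ⁿ/σ`, all `n` — the `p = 2` half of the LINEAR sector of
  `CyclicQuotientFourfolds` (stmt-17941), in all dimensions (includes the non-Cohen–Macaulay
  quotients `𝔸^{2m}/J₂^{⊕m}`, `m ≥ 3`, in any linear disguise).
-/

-- single-problem summit: the doubled namespace component `ResolutionOfSingularities` is forced
set_option linter.dupNamespace false

noncomputable section

open Module MvPolynomial AlgebraicGeometry CategoryTheory Literature.AlgebraicGeometry.Resolution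

namespace Summit.ResolutionOfSingularities.ResolutionOfSingularities.Theorems.WildQuotientResolution.LinearSqZero

/-- **Linear changes of coordinates.** For every basis `b` of the degree-one part
`span k {X i}` of `k[x₁,…,xₙ]` there is a `k`-algebra automorphism `φ` of `k[x₁,…,xₙ]` with
`φ (X i) = b i` for all `i`. [folklore] -/
theorem exists_algEquiv_apply_X_eq (k : Type*) [Field k] (n : ℕ)
    (b : Basis (Fin n) k (Submodule.span k (Set.range (X : Fin n → MvPolynomial (Fin n) k)))) :
    ∃ φ : MvPolynomial (Fin n) k ≃ₐ[k] MvPolynomial (Fin n) k, ∀ i, φ (X i) = b i := by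
  classical
  let L := Submodule.span k (Set.range (X : Fin n → MvPolynomial (Fin n) k))
  have hXL : ∀ i, (X i : MvPolynomial (Fin n) k) ∈ L := fun i => Submodule.subset_span ⟨i, rfl⟩
  have hX : LinearIndependent k (X : Fin n → MvPolynomial (Fin n) k) :=
    MvPolynomial.linearIndependent_X _ _
  let bX : Basis (Fin n) k L := Basis.span hX
  haveI : FiniteDimensional k L := Module.Finite.of_basis bX
  -- the two algebra endomorphisms
  let φ₀ : MvPolynomial (Fin n) k →ₐ[k] MvPolynomial (Fin n) k :=
    aeval fun i => (b i : MvPolynomial (Fin n) k)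
  let ψ₀ : MvPolynomial (Fin n) k →ₐ[k] MvPolynomial (Fin n) k :=
    aeval fun i => ∑ j, b.repr ⟨X i, hXL i⟩ j • (X j : MvPolynomial (Fin n) k)
  have hφ₀ : ∀ i, φ₀ (X i) = b i := fun i => aeval_X _ i
  have hψ₀ : ∀ i, ψ₀ (X i) = ∑ j, b.repr ⟨X i, hXL i⟩ j • (X j : MvPolynomial (Fin n) k) :=
    fun i => aeval_X _ i
  -- `φ₀ ∘ ψ₀ = id` by the basis expansion of `X i` in `b`
  have h₁ : ∀ i, φ₀ (ψ₀ (X i)) = X i := by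
    intro i
    rw [hψ₀, map_sum]
    simp_rw [map_smul, hφ₀]
    have h := congrArg Subtype.val (b.sum_repr ⟨X i, hXL i⟩)
    simpa only [AddSubmonoidClass.coe_finsetSum, Submodule.coe_smul] using h
  have hcomp₁ : φ₀.comp ψ₀ = AlgHom.id k _ :=
    MvPolynomial.algHom_ext fun i => by rw [AlgHom.comp_apply, AlgHom.id_apply, h₁]
  -- both preserve the finite-dimensional `L`, so `ψ₀ ∘ φ₀ = id` on `L` as well
  have hφL : ∀ x ∈ L, φ₀.toLinearMap x ∈ L := by
    intro x hx
    have h : Submodule.map φ₀.toLinearMap L ≤ L := by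
      change Submodule.map φ₀.toLinearMap (Submodule.span k _) ≤ L
      rw [Submodule.map_span_le]
      rintro _ ⟨i, rfl⟩
      rw [AlgHom.toLinearMap_apply, hφ₀]
      exact (b i).2
    exact h ⟨x, hx, rfl⟩
  have hψL : ∀ x ∈ L, ψ₀.toLinearMap x ∈ L := by
    intro x hx
    have h : Submodule.map ψ₀.toLinearMap L ≤ L := by
      change Submodule.map ψ₀.toLinearMap (Submodule.span k _) ≤ L
      rw [Submodule.map_span_le]
      rintro _ ⟨i, rfl⟩
      rw [AlgHom.toLinearMap_apply, hψ₀]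
      exact Submodule.sum_mem _ fun j _ => Submodule.smul_mem _ _ (hXL j)
    exact h ⟨x, hx, rfl⟩
  have hone : φ₀.toLinearMap.restrict hφL * ψ₀.toLinearMap.restrict hψL = 1 := by
    ext x
    rw [Module.End.mul_apply, Module.End.one_apply, LinearMap.coe_restrict_apply,
      LinearMap.coe_restrict_apply, AlgHom.toLinearMap_apply, AlgHom.toLinearMap_apply,
      ← AlgHom.comp_apply, hcomp₁, AlgHom.id_apply]
  have hone' := mul_eq_one_comm.mp hone
  have h₂ : ∀ i, ψ₀ (φ₀ (X i)) = X i := by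
    intro i
    have h := congrArg (fun g : L →ₗ[k] L => ((g ⟨X i, hXL i⟩ : L) : MvPolynomial (Fin n) k))
      hone'
    simpa only [Module.End.mul_apply, Module.End.one_apply, LinearMap.coe_restrict_apply,
      AlgHom.toLinearMap_apply] using h
  have hcomp₂ : ψ₀.comp φ₀ = AlgHom.id k _ :=
    MvPolynomial.algHom_ext fun i => by rw [AlgHom.comp_apply, AlgHom.id_apply, h₂]
  exact ⟨AlgEquiv.ofAlgHom φ₀ ψ₀ hcomp₁ hcomp₂, fun i => hφ₀ i⟩

/-- **SQZ-2** (`W45cPlanSignaturesV4.lean` §A, verbatim): a LINEAR automorphism `σ` of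
`k[x₁,…,xₙ]` with `(σ − 1)² = 0` on the coordinates is conjugate in `Aut_k k[x]` to an LSB datum:
`(τ σ τ⁻¹) xᵢ = xᵢ + x_{f i}` for `i ∈ D`, `= xᵢ` for `i ∉ D`, `f(D) ∩ D = ∅`. (`τ⁻¹ = φ`, the
coordinate change to a square-zero normal-form basis of `N = σ − 1` on the degree-one part.)
[folklore] -/
theorem exists_conj_linearSmallBlocks_of_sq_zero (k : Type*) [Field k] (n : ℕ)
    (σ : MvPolynomial (Fin n) k ≃ₐ[k] MvPolynomial (Fin n) k)
    (hlin : ∀ i, σ (X i) ∈ Submodule.span k (Set.range (X : Fin n → MvPolynomial (Fin n) k)))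
    (hsq : ∀ i, σ (σ (X i) - X i) = σ (X i) - X i) :
    ∃ (τ : MvPolynomial (Fin n) k ≃ₐ[k] MvPolynomial (Fin n) k) (D : Finset (Fin n))
      (f : Fin n → Fin n), (∀ i ∈ D, f i ∉ D) ∧
      (∀ i ∈ D, (τ * σ * τ⁻¹) (X i) = X i + X (f i)) ∧ (∀ i ∉ D, (τ * σ * τ⁻¹) (X i) = X i) := by
  classical
  let L := Submodule.span k (Set.range (X : Fin n → MvPolynomial (Fin n) k))
  have hX : LinearIndependent k (X : Fin n → MvPolynomial (Fin n) k) :=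
    MvPolynomial.linearIndependent_X _ _
  let bX : Basis (Fin n) k L := Basis.span hX
  haveI : FiniteDimensional k L := Module.Finite.of_basis bX
  have hcard : Fintype.card (Fin n) = Module.finrank k L := (Module.finrank_eq_card_basis bX).symm
  -- `σ` restricted to the degree-one part, and `N = σ − 1` there
  have hσL : ∀ x ∈ L, σ.toLinearMap x ∈ L := by
    intro x hx
    have h : Submodule.map σ.toLinearMap L ≤ L := by
      change Submodule.map σ.toLinearMap (Submodule.span k _) ≤ L
      rw [Submodule.map_span_le]
      rintro _ ⟨i, rfl⟩
      exact hlin i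
    exact h ⟨x, hx, rfl⟩
  let N : L →ₗ[k] L := σ.toLinearMap.restrict hσL - LinearMap.id
  have hNval : ∀ x : L, ((N x : L) : MvPolynomial (Fin n) k) = σ x - x := fun x => rfl
  have hN : N ∘ₗ N = 0 := by
    refine bX.ext fun i => Subtype.ext ?_
    rw [LinearMap.comp_apply, hNval, hNval, LinearMap.zero_apply, Submodule.coe_zero]
    have hbX : ((bX i : L) : MvPolynomial (Fin n) k) = X i :=
      congrArg Subtype.val (Basis.span_apply hX i)
    rw [hbX, hsq i, sub_self]
  -- square-zero normal form and the coordinate change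
  obtain ⟨b, D, f, hfD, hD, hoff⟩ := exists_basis_of_sq_zero_index N hN hcard
  obtain ⟨φ, hφ⟩ := exists_algEquiv_apply_X_eq k n b
  have hσb : ∀ i, σ (b i : MvPolynomial (Fin n) k) = b i + N (b i) := by
    intro i
    rw [hNval, add_sub_cancel]
  refine ⟨φ.symm, D, f, hfD, fun i hi => ?_, fun i hi => ?_⟩
  · rw [AlgEquiv.mul_apply, AlgEquiv.mul_apply, AlgEquiv.aut_inv, AlgEquiv.symm_symm, hφ, hσb,
      hD i hi, ← hφ i, ← hφ (f i), ← map_add, AlgEquiv.symm_apply_apply]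
  · rw [AlgEquiv.mul_apply, AlgEquiv.mul_apply, AlgEquiv.aut_inv, AlgEquiv.symm_symm, hφ, hσb,
      hoff i hi, Submodule.coe_zero, add_zero, ← hφ i, AlgEquiv.symm_apply_apply]

/-- **SQZ-3** (`W45cPlanSignaturesV4.lean` §A, verbatim): every LINEAR `σ` with `(σ − 1)² = 0`
on the coordinates has a resolvable quotient `𝔸ⁿ/⟨σ⟩ = Spec k[x₁,…,xₙ]^⟨σ⟩`, in every
characteristic `p` and every `n` (rung LSB p471938 for the conjugate `τ σ τ⁻¹`, transported back
by p471072 with `τ⁻¹`). [OURS · L1 W4.5c]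
[cite: KiralyLutkebohmert2013, Thm 2] [cite: SGA1, Exp. V, §1–2] -/
theorem linearSqZero_hasResolution (p : ℕ) (hp : p.Prime) (k : Type) [Field k] [CharP k p] (n : ℕ)
    (σ : MvPolynomial (Fin n) k ≃ₐ[k] MvPolynomial (Fin n) k)
    (hlin : ∀ i, σ (X i) ∈ Submodule.span k (Set.range (X : Fin n → MvPolynomial (Fin n) k)))
    (hsq : ∀ i, σ (σ (X i) - X i) = σ (X i) - X i) :
    Scheme.HasResolution
      (Spec (.of (FixedPoints.subalgebra k (MvPolynomial (Fin n) k) (Subgroup.zpowers σ)))) := by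
  obtain ⟨τ, D, f, hfD, hD, hoff⟩ := exists_conj_linearSmallBlocks_of_sq_zero k n σ hlin hsq
  have h := LinearSmallBlocks.hasResolution p hp k n (τ * σ * τ⁻¹) D f hfD hD hoff
  have h' := TameTransfer.hasResolution_fixedPoints_zpowers_conj (τ * σ * τ⁻¹) τ⁻¹ h
  have e : τ⁻¹ * (τ * σ * τ⁻¹) * τ⁻¹⁻¹ = σ := by group
  rw [e] at h'
  exact h'

/-- **SQZ-4** (`W45cPlanSignaturesV4.lean` §A, verbatim): EVERY linear involution `σ` of `𝔸ⁿ_k`,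
`char k = 2`, has a resolvable quotient `𝔸ⁿ/σ` — all `n` (`(σ − 1)² = σ² − 2σ + 1 = 0`). This is
the `p = 2` half of the LINEAR sector of `CyclicQuotientFourfolds` (stmt-17941), in all
dimensions. [OURS · L1 W4.5c] [cite: KiralyLutkebohmert2013, Thm 2] -/
theorem linearInvolution_hasResolution_charTwo (k : Type) [Field k] [CharP k 2] (n : ℕ)
    (σ : MvPolynomial (Fin n) k ≃ₐ[k] MvPolynomial (Fin n) k)
    (hlin : ∀ i, σ (X i) ∈ Submodule.span k (Set.range (X : Fin n → MvPolynomial (Fin n) k)))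
    (hinv : ∀ i, σ (σ (X i)) = X i) :
    Scheme.HasResolution
      (Spec (.of (FixedPoints.subalgebra k (MvPolynomial (Fin n) k) (Subgroup.zpowers σ)))) := by
  refine linearSqZero_hasResolution 2 (by norm_num) k n σ hlin ?_
  intro i
  rw [map_sub, hinv i]
  have h2 := CharTwo.neg_eq (σ (X i) - X i)
  rw [neg_sub] at h2
  exact h2

end Summit.ResolutionOfSingularities.ResolutionOfSingularities.Theorems.WildQuotientResolution.LinearSqZero

end
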